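import Literature.AlgebraicGeometry.AbelianSchemes.SerreTensorFunctoriality
import HarnessLib

/-!
# Serre's tensor construction: rectangular matrix homomorphisms `[P] : Aⁿ ⟶ Aᵐ`, independence of the presentation
# `𝔟 = E·𝒪ⁿ`, and `A ⊗_𝒪 𝒪 ≅ A`

Topic `AlgebraicGeometry/AbelianSchemes`, namespace `Literature.AlgebraicGeometry.AbelianSchemes.AbelianSchemeOver` (constructions with
bodies + proved theorems; no named fact, no `sorry`, no `instance`, no notation; any base `S`).  Cell `hodgecm-mathlib`, F0/P6 «MOD»,
P6a organ (g2) FILE 5 over ★ FILE 3 `SerreTensorFunctoriality`; `--supports stmt-HodgeConjecture-24832`, count-neutral.  HC_CM is proved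
only modulo the 2 remaining named inputs (hLiu418, h413) until rung 0 closes; this file discharges none of them.

## Mathematics (B. Conrad, *Gross–Zagier revisited* §7: `M ⊗_R A` depends only on the module `M`; `R ⊗_R A = A`)

A matrix `P ∈ M_{m×n}(𝒪)` acts by the homomorphism `[P] : Aⁿ → Aᵐ` (`[PQ] = [Q] ≫ [P]`, `[1] = 𝟙`; for square `P` this is ★ `matrixEnd`).
Two presentations `𝔟 ≅ E·𝒪ⁿ ≅ E'·𝒪ᵐ` of ONE finitely generated projective module are intertwined by `P ∈ M_{m×n}`, `Q ∈ M_{n×m}` with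
`QP = E`, `PQ = E'` (for the isomorphism `φ` take `P = E'φE`, `Q = Eφ⁻¹E'`); then `E'P = PE`, so `[P]` and `[Q]` restrict to inverse
isomorphisms `Fix([E]) ≅ Fix([E'])` — `A ⊗_𝒪 𝔟` is independent of the presentation, compatibly with the `𝒪`-actions.  The trivial
presentation `𝒪 = 1·𝒪¹` gives `A ⊗_𝒪 𝒪 = Fix(𝟙 ↷ A¹) = A¹ ≅ A`, `𝒪`-equivariantly.

## Contents

* §1 `matrixCompRect`, **`matrixHom act P : (A.pow n).X ⟶ (A.pow m).X`** (`matrixHom_square : matrixHom act M = matrixEnd act M`, rfl),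
  `powHomEquiv_comp_matrixHom`, `isMonHom_matrixHom`, **`matrixHom_mul`**, `matrixHom_one`;
* §2 `intertwine_of_presentations`, `matrixHom_intertwines`, `serrePresentationHom` (`_ι`, hom), `fixedHom_self`,
  `serrePresentationHom_comp`, **`serrePresentationIso act E hE E' hE' P Q hQP hPQ : (serreTensor act E hE).X ≅ (serreTensor act E' hE').X`**,
  `serreAction_comp_serrePresentationHom` (equivariance);
* §3 `powOneIso : (A.pow 1).X ≅ A.X`, **`serreTensorOneIso act : (serreTensor act 1 _).X ≅ A.X`** (+ homs, `serreTensorOneIso_equivariant`).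

## References
* [Conrad2004GrossZagier] B. Conrad, *Gross–Zagier revisited*, MSRI Publ. 49 (2004), §7 «The Serre tensor construction» (p. 98).
* [Kottwitz1992] §5 (p. 390); [MumfordFogartyKirwan1994] Ch. 6 §1 Def. 6.1, Cor. 6.4; [GortzWedhorn2020] Def. 9.1 (3), Prop. 9.3.
* Tree: ★ `AbelianSchemes/SerreTensorFunctoriality` (FILE 3) and its imports.
-/

noncomputable section

universe u

open CategoryTheory CategoryTheory.Limits AlgebraicGeometry MonoidalCategory CartesianMonoidalCategory
open scoped MonObj

namespace Literature.AlgebraicGeometry.AbelianSchemes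

namespace AbelianSchemeOver

variable {S : Scheme.{u}} {A : AbelianSchemeOver S} {O : Type*} [CommRing O] (act : A.RingAction O) [IsCommMonObj A.X]

/-! ## §1 Rectangular matrices: `[P] : Aⁿ ⟶ Aᵐ` for `P ∈ M_{m×n}(𝒪)` -/

section MatrixHom

variable {m n p : ℕ}

/-- The `j`-th coordinate of `P · x` for `P ∈ M_{m×n}(𝒪)` and a tuple of points `x = (x_k)_{k<n}`: `∏_k x_k ≫ ι(P j k)`.
[cite: Kottwitz1992, §5 (p. 390)] -/
def matrixCompRect (P : Matrix (Fin m) (Fin n) O) {T : Over S} (x : Fin n → (T ⟶ A.X)) (j : Fin m) : T ⟶ A.X :=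
  ∏ k : Fin n, x k ≫ act.i (P j k)

/-- For square matrices `matrixCompRect = matrixComp`. [cite: Kottwitz1992, §5 (p. 390)] -/
theorem matrixCompRect_square (M : Matrix (Fin n) (Fin n) O) {T : Over S} (x : Fin n → (T ⟶ A.X)) :
    matrixCompRect act M x = matrixComp act M x := rfl

/-- `(P Q) · x = P · (Q · x)` (`P ∈ M_{m×n}`, `Q ∈ M_{n×p}`). [cite: Kottwitz1992, §5 (p. 390)] -/
theorem matrixCompRect_mul (P : Matrix (Fin m) (Fin n) O) (Q : Matrix (Fin n) (Fin p) O) {T : Over S} (x : Fin p → (T ⟶ A.X)) :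
    matrixCompRect act (P * Q) x = matrixCompRect act P (matrixCompRect act Q x) := by
  funext j
  unfold matrixCompRect
  simp only [Matrix.mul_apply, i_finset_sum, comp_finset_prod]
  haveI : ∀ a, IsMonHom (act.i a) := act.isMonHom
  simp only [finset_prod_comp, Category.assoc, ← act.i_mul]
  rw [Finset.prod_comm]

/-- `P · (t ≫ x) = t ≫ (P · x)` (naturality in `T`). [cite: Kottwitz1992, §5 (p. 390)] -/
theorem matrixCompRect_comp (P : Matrix (Fin m) (Fin n) O) {T T' : Over S} (t : T' ⟶ T) (x : Fin n → (T ⟶ A.X)) :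
    matrixCompRect act P (fun k => t ≫ x k) = fun j => t ≫ matrixCompRect act P x j := by
  funext j
  unfold matrixCompRect
  rw [comp_finset_prod]
  exact Finset.prod_congr rfl fun k _ => Category.assoc t (x k) (act.i (P j k))

/-- **`[P] : Aⁿ ⟶ Aᵐ`** for `P ∈ M_{m×n}(𝒪)`: `(x_k)_k ↦ (∏_k x_k ≫ ι(P j k))_j` (defined on the universal point).
[cite: Kottwitz1992, §5 (p. 390)] -/
def matrixHom (P : Matrix (Fin m) (Fin n) O) : (A.pow n).X ⟶ (A.pow m).X :=
  powLift (matrixCompRect act P fun k => A.powProj n k)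

/-- For square matrices `[M]` is the endomorphism `matrixEnd act M` of FILE 2 (definitionally). [cite: Kottwitz1992, §5 (p. 390)] -/
theorem matrixHom_square (M : Matrix (Fin n) (Fin n) O) : matrixHom act M = matrixEnd act M := rfl

/-- On points, `[P]` is `x ↦ P · x`. [cite: Kottwitz1992, §5 (p. 390)] -/
theorem powHomEquiv_comp_matrixHom (P : Matrix (Fin m) (Fin n) O) {T : Over S} (g : T ⟶ (A.pow n).X) :
    powHomEquiv A m T (g ≫ matrixHom act P) = matrixCompRect act P (powHomEquiv A n T g) := by
  funext j
  rw [powHomEquiv_apply, matrixHom, Category.assoc, powLift_powProj]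
  exact (congrFun (matrixCompRect_comp act P g fun k => A.powProj n k) j).symm

/-- On the universal point: the coordinates of `[P]` are `P · (pr_k)_k`. [cite: Kottwitz1992, §5 (p. 390)] -/
theorem powHomEquiv_matrixHom (P : Matrix (Fin m) (Fin n) O) :
    powHomEquiv A m _ (matrixHom act P) = matrixCompRect act P (fun k => A.powProj n k) :=
  (powHomEquiv A m _).apply_symm_apply _

/-- `[P]` is a homomorphism. [cite: Kottwitz1992, §5 (p. 390)] -/
theorem isMonHom_matrixHom (P : Matrix (Fin m) (Fin n) O) : IsMonHom (matrixHom act P) := by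
  unfold matrixHom matrixCompRect
  refine isMonHom_powLift _ fun j => isMonHom_finset_prod _ _ fun k _ => ?_
  haveI := A.isMonHom_powProj n k
  haveI := act.isMonHom (P j k)
  infer_instance

/-- `[P Q] = [Q] ≫ [P]`. [cite: Kottwitz1992, §5 (p. 390)] -/
theorem matrixHom_mul (P : Matrix (Fin m) (Fin n) O) (Q : Matrix (Fin n) (Fin p) O) :
    matrixHom act (P * Q) = matrixHom act Q ≫ matrixHom act P := by
  apply (powHomEquiv A m _).injective
  rw [powHomEquiv_matrixHom, matrixCompRect_mul, powHomEquiv_comp_matrixHom, powHomEquiv_matrixHom]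

/-- `[1] = 𝟙`. [cite: Kottwitz1992, §5 (p. 390)] -/
theorem matrixHom_one : matrixHom act (1 : Matrix (Fin n) (Fin n) O) = 𝟙 (A.pow n).X := by
  rw [matrixHom_square, matrixEnd_one]

end MatrixHom

/-! ## §2 Independence of the presentation: `Fix([E]) ≅ Fix([E'])` for intertwined idempotents -/

section Presentation

variable {m n : ℕ} (E : Matrix (Fin n) (Fin n) O) (hE : E * E = E) (E' : Matrix (Fin m) (Fin m) O) (hE' : E' * E' = E')
  (P : Matrix (Fin m) (Fin n) O) (Q : Matrix (Fin n) (Fin m) O)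

/-- Two presentations `𝔟 ≅ E·𝒪ⁿ ≅ E'·𝒪ᵐ` of one finitely generated projective module are INTERTWINED by `P ∈ M_{m×n}`, `Q ∈ M_{n×m}`
with `Q P = E`, `P Q = E'` (take `P = E' φ E`, `Q = E φ⁻¹ E'` for the isomorphism `φ`); then `E' P = P E` (both equal `P Q P`).
[cite: Conrad2004GrossZagier, §7] -/
theorem intertwine_of_presentations (hQP : Q * P = E) (hPQ : P * Q = E') : E' * P = P * E := by
  rw [← hPQ, ← hQP, Matrix.mul_assoc]

/-- `[P]` intertwines `[E]` and `[E']`: `[P] ≫ [E'] = [E] ≫ [P]`. [cite: Conrad2004GrossZagier, §7] -/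
theorem matrixHom_intertwines (hQP : Q * P = E) (hPQ : P * Q = E') :
    matrixHom act P ≫ matrixEnd act E' = matrixEnd act E ≫ matrixHom act P := by
  rw [← matrixHom_square, ← matrixHom_square, ← matrixHom_mul, ← matrixHom_mul, intertwine_of_presentations E E' P Q hQP hPQ]

/-- **The comparison `A ⊗_𝒪 𝔟 (via E) ⟶ A ⊗_𝒪 𝔟 (via E')`** induced by the intertwiner `[P]` (★ `fixedHom`).
[cite: Conrad2004GrossZagier, §7] -/
def serrePresentationHom : (serreTensor act E hE).X ⟶ (serreTensor act E' hE').X :=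
  haveI := isMonHom_matrixEnd act E
  haveI := isMonHom_matrixEnd act E'
  fixedHom (matrixEnd act E) (matrixEnd act E') (matrixEnd_idem act hE') (matrixHom act P)

/-- `serrePresentationHom ≫ ι' = ι ≫ [P]`. [cite: Conrad2004GrossZagier, §7] -/
@[reassoc]
theorem serrePresentationHom_ι (hQP : Q * P = E) (hPQ : P * Q = E') :
    serrePresentationHom act E hE E' hE' P ≫ serreι act E' hE' = serreι act E hE ≫ matrixHom act P :=
  haveI := isMonHom_matrixEnd act E
  haveI := isMonHom_matrixEnd act E'
  fixedHom_ι (matrixEnd act E) (matrixEnd act E') (matrixEnd_idem act hE') (matrixHom act P)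
    (matrixHom_intertwines act E E' P Q hQP hPQ)

/-- `serrePresentationHom` is a homomorphism. [cite: Conrad2004GrossZagier, §7] -/
theorem isMonHom_serrePresentationHom : IsMonHom (serrePresentationHom act E hE E' hE' P) := by
  haveI := isMonHom_matrixEnd act E
  haveI := isMonHom_matrixEnd act E'
  haveI := isMonHom_matrixHom act P
  exact isMonHom_fixedHom (matrixEnd act E) (matrixEnd act E') (matrixEnd_idem act hE') (matrixHom act P)

/-- `fixedHom e e he e = 𝟙`: the idempotent itself induces the identity of `Fix(e)`. [cite: GortzWedhorn2020, Definition 9.1 (3) and Proposition 9.3] -/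
theorem fixedHom_self {B : AbelianSchemeOver S} (e : B.X ⟶ B.X) [IsMonHom e] (he : e ≫ e = e) : fixedHom e e he e = 𝟙 _ := by
  haveI := mono_fixedι e
  rw [← cancel_mono (fixedι e), fixedHom_ι e e he e rfl, fixedι_comp, Category.id_comp]

/-- **Independence of the presentation**: `[P]` and `[Q]` induce inverse isomorphisms `A ⊗_𝒪 𝔟 (via E) ≅ A ⊗_𝒪 𝔟 (via E')`.
[cite: Conrad2004GrossZagier, §7] -/
theorem serrePresentationHom_comp (hQP : Q * P = E) (hPQ : P * Q = E') :
    serrePresentationHom act E hE E' hE' P ≫ serrePresentationHom act E' hE' E hE Q = 𝟙 _ := by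
  haveI := isMonHom_matrixEnd act E
  haveI := isMonHom_matrixEnd act E'
  have h := (fixedHom_comp (matrixEnd act E) (matrixEnd act E') (matrixEnd_idem act hE') (matrixHom act P)
      (matrixHom_intertwines act E E' P Q hQP hPQ) (matrixEnd act E) (matrixEnd_idem act hE) (matrixHom act Q)
      (matrixHom_intertwines act E' E Q P hPQ hQP)).symm
  rw [← matrixHom_mul, hQP, matrixHom_square, fixedHom_self] at h
  exact h

/-- **`A ⊗_𝒪 𝔟` does not depend on the presentation**: the isomorphism `(serreTensor act E hE).X ≅ (serreTensor act E' hE').X` for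
intertwined presentations (`Q P = E`, `P Q = E'`). [cite: Conrad2004GrossZagier, §7] -/
def serrePresentationIso (hQP : Q * P = E) (hPQ : P * Q = E') : (serreTensor act E hE).X ≅ (serreTensor act E' hE').X where
  hom := serrePresentationHom act E hE E' hE' P
  inv := serrePresentationHom act E' hE' E hE Q
  hom_inv_id := serrePresentationHom_comp act E hE E' hE' P Q hQP hPQ
  inv_hom_id := serrePresentationHom_comp act E' hE' E hE Q P hPQ hQP

/-- The presentation isomorphism is `𝒪`-equivariant for the induced actions. [cite: Conrad2004GrossZagier, §7] -/
theorem serreAction_comp_serrePresentationHom (hQP : Q * P = E) (hPQ : P * Q = E') (a : O) :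
    (serreAction act E hE).i a ≫ serrePresentationHom act E hE E' hE' P =
      serrePresentationHom act E hE E' hE' P ≫ (serreAction act E' hE').i a := by
  haveI := (isMonHom_serreι_serreπ act E' hE').2.2
  have hmat : Matrix.scalar (Fin m) a * P = P * Matrix.scalar (Fin n) a := by
    ext i j
    simp only [Matrix.scalar_apply, Matrix.diagonal_mul, Matrix.mul_diagonal, mul_comm]
  have hsc : matrixHom act P ≫ matrixEnd act (Matrix.scalar (Fin m) a) = matrixEnd act (Matrix.scalar (Fin n) a) ≫ matrixHom act P := by
    rw [← matrixHom_square, ← matrixHom_square, ← matrixHom_mul, ← matrixHom_mul, hmat]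
  rw [← cancel_mono (serreι act E' hE'), Category.assoc, serrePresentationHom_ι act E hE E' hE' P Q hQP hPQ,
    serreAction_i_comp_ι_assoc, Category.assoc, serreAction_i_comp_ι, serrePresentationHom_ι_assoc act E hE E' hE' P Q hQP hPQ, hsc]

end Presentation

/-! ## §3 `A ⊗_𝒪 𝒪 ≅ A` (the presentation `n = 1`, `E = 1`) -/

section One

/-- `A¹ ≅ A`: `hom := pr₀`, `inv := (𝟙)` (the one-coordinate tuple). [cite: MumfordFogartyKirwan1994, Ch. 6 §1 Definition 6.1 (p. 115)] -/
def powOneIso (A : AbelianSchemeOver S) : (A.pow 1).X ≅ A.X where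
  hom := A.powProj 1 0
  inv := powLift fun _ => 𝟙 A.X
  hom_inv_id := pow_hom_ext fun k => by
    rw [Category.assoc, powLift_powProj, Category.comp_id, Category.id_comp, Fin.fin_one_eq_zero k]
  inv_hom_id := powLift_powProj _ _

/-- Both directions of `A¹ ≅ A` are homomorphisms. [cite: MumfordFogartyKirwan1994, Ch. 6 §1 Corollary 6.4 (p. 117)] -/
theorem isMonHom_powOneIso (A : AbelianSchemeOver S) : IsMonHom (powOneIso A).hom ∧ IsMonHom (powOneIso A).inv := by
  haveI : IsMonHom (powOneIso A).hom := A.isMonHom_powProj 1 0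
  exact ⟨‹_›, inferInstance⟩

/-- `1 * 1 = 1` for the `1 × 1` identity matrix (the idempotency witness of the trivial presentation). [cite: Kottwitz1992, §5 (p. 390)] -/
theorem one_mul_one_fin_one : (1 : Matrix (Fin 1) (Fin 1) O) * 1 = 1 := Matrix.mul_one 1

/-- **`A ⊗_𝒪 𝒪 ≅ A`** for the trivial presentation `𝒪 = 1·𝒪¹`: `Fix([1] ↷ A¹) = A¹ ≅ A` (`hom := ι ≫ pr₀`, `inv := (𝟙) ≫ π`).
[cite: Conrad2004GrossZagier, §7] -/
def serreTensorOneIso : (serreTensor act (1 : Matrix (Fin 1) (Fin 1) O) one_mul_one_fin_one).X ≅ A.X where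
  hom := serreι act 1 one_mul_one_fin_one ≫ (powOneIso A).hom
  inv := (powOneIso A).inv ≫ serreπ act 1 one_mul_one_fin_one
  hom_inv_id := by
    rw [Category.assoc, (powOneIso A).hom_inv_id_assoc, (serreπ_ι_and_ι_π act 1 one_mul_one_fin_one).2]
  inv_hom_id := by
    rw [Category.assoc, ← Category.assoc (serreπ act 1 _), (serreπ_ι_and_ι_π act 1 one_mul_one_fin_one).1, matrixEnd_one,
      Category.id_comp, (powOneIso A).inv_hom_id]

/-- Both directions of `A ⊗_𝒪 𝒪 ≅ A` are homomorphisms. [cite: Conrad2004GrossZagier, §7] -/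
theorem isMonHom_serreTensorOneIso : IsMonHom (serreTensorOneIso act).hom ∧ IsMonHom (serreTensorOneIso act).inv := by
  haveI := (isMonHom_serreι_serreπ act (1 : Matrix (Fin 1) (Fin 1) O) one_mul_one_fin_one).1
  haveI := (isMonHom_powOneIso A).1
  haveI : IsMonHom (serreTensorOneIso act).hom := by
    change IsMonHom (serreι act 1 one_mul_one_fin_one ≫ (powOneIso A).hom)
    infer_instance
  exact ⟨‹_›, inferInstance⟩

/-- `A ⊗_𝒪 𝒪 ≅ A` is `𝒪`-equivariant: the induced action corresponds to `ι`. [cite: Conrad2004GrossZagier, §7] -/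
theorem serreTensorOneIso_equivariant (a : O) :
    (serreAction act (1 : Matrix (Fin 1) (Fin 1) O) one_mul_one_fin_one).i a ≫ (serreTensorOneIso act).hom =
      (serreTensorOneIso act).hom ≫ act.i a := by
  change _ ≫ serreι act 1 one_mul_one_fin_one ≫ (powOneIso A).hom = (serreι act 1 one_mul_one_fin_one ≫ (powOneIso A).hom) ≫ _
  rw [serreAction_i_comp_ι_assoc, Category.assoc]
  congr 1
  change matrixEnd act (Matrix.scalar (Fin 1) a) ≫ A.powProj 1 0 = A.powProj 1 0 ≫ act.i a
  rw [← Category.id_comp (matrixEnd act _), ← powHomEquiv_apply (𝟙 _ ≫ matrixEnd act _), powHomEquiv_comp_matrixEnd]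
  unfold matrixComp
  rw [Fin.prod_univ_one, powHomEquiv_apply, Category.id_comp, Matrix.scalar_apply, Matrix.diagonal_apply_eq]

end One


end AbelianSchemeOver

end Literature.AlgebraicGeometry.AbelianSchemes

end
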